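import Summits.CriticalPhenomena.PercolationContinuityZ3.Theorems.PercNearOneGluingNoHeavyConstsOneCopyBHK
import Summits.CriticalPhenomena.PercolationContinuityZ3.Theorems.Transplant.FKConnectivityAllQFastEvalBridge
import HarnessLib

/-!
# KERNEL REFUTATIONS of the two refined one-copy conjectures of `…ConstsOneCopyBHK.lean`:
# `¬ Consts.OneCopyContainBHK` (fails on `Fin 7`) and `¬ Consts.CrossReachBHK` (fails on `Fin 8`)

builds on p205010 (kernel theorem, internal audit signed; external expert review pending).  Support file (`--supports
stmt-CriticalPhenomena-4575`), lead seat `prim-nh-lead-4575` (gen 108; witnesses found gen 106, memo LEAD-GEN106 §6–§7, evidence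
`CONTAIN-CEX.md` / `CROSSREACH-CEX.md` on stmt-4575).  Two listed graphs (definitions), Boolean readers, no named facts, no sorries;
standard axioms (`decide +kernel` on fk-1 g17's verified fast evaluator `…Transplant.FKConnectivityAllQFastEval*.lean`; no `native_decide`).

THE WITNESSES (both in the ANTIPODAL fibre `u = ∅`, `M = E(G)`, source set `S = {5}`, increasing cluster predicates
`P = [2 ∈ V(C)]`, `Q = [6 ∈ V(C)]`, i.e. `P C ⟺ ∃ e ∈ C, 2 ∈ e`):
* CONTAINMENT (`Consts.OneCopyContainBHK`, "copy 0's cluster contains `A`"): `G₇` on `Fin 7` with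
  `E = {03, 04, 13, 15, 24, 25, 35, 45, 16, 56}` (10 pairs), `A = {0}`:  the four fibre counts are
  `L₁ = N(Cont∩U_P ; U_Q) = 252`, `L₂ = N(Cont∩U_Q ; U_P) = 206`, `R₁ = N(Cont∩U_P∩U_Q ; ⊤) = 277`, `R₂ = N(Cont ; U_P∩U_Q) = 180`, and
  `252 + 206 = 458 > 457 = 277 + 180` (`Cont = {5 ↔ 0}`);
* CROSS-REACH (`Consts.CrossReachBHK`, "copy 0 misses `v`, copy 1 reaches `v`"): `G₈ = G₇ + 07` on `Fin 8` (11 pairs), `v = 7`: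
  `206 + 252 = 458 > 457 = 180 + 277`.
Both were found by the gen-106 sharpness probe (the in-sided stratum `K₂ + K₁/2` is tight with ratio `2/3, 4/5, 1` at `n = 4, 5, 6` and
fails at `n = 7`; the cross-reach stratum fails on the one-vertex extension) and re-derived by independent exact engines
(lab-gen106/hc/contain_cex.py, xcex.py; this seat lab/cex108/counts.py with the mask conventions of the evaluator).  Both conjectures were
census-clean on all graphs with `n ≤ 6` and on `n = 7, m ≤ 9`; the sibling `Consts.OneCopyRepelBHK` (one-copy AVOIDANCE) is a kernel
THEOREM (`Consts.oneCopyRepelBHK_holds`, p337798/p338298) and the hard-core inequality (HC) / PA-BERN (`Consts.HardCoreBHK`,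
`Consts.FibrewiseBHK`) remain open: on the `Fin 8` witness the vacant stratum pays for the negative cross-reach stratum (`K₀ = 22 ≥ 2 = −K₁`).

THE CERTIFICATE (pattern of `…Transplant.FKConnectivityAllQForestSquareCex.lean`): the listed-graph data `cexC` / `cexX` : `FK.RCEval`;
`joinedB ∘ compsOf` decides open reachability of the configuration of a mask (`joinedB_iff`); "`x ∈ V(C_s)`" for `x ≠ s` is open
reachability `s ↔ x` (`Consts.exists_mem_openEdgeCluster_iff`, this file); a fibre count on `(conf (firstT d), ∅)` is a count of masks
`a < 2^d` (`fibreCount_conf_eq_card_bool`) = a binary-split sum `sumR` (`card_filter_range_eq_sumR`), evaluated by `decide +kernel`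
(eight sums over `2¹⁰` resp. `2¹¹` masks, a few seconds each); the conjecture's inline filter cards are identified with `fibreCount`s by
pointwise filter congruence (`Consts.card_filter_congr_prop`, decidability instances explicit).
CLASSIFICATION: refuted-substantive for both (house conjectures typed 2026-08-22 in p336343; the load-bearing claims "one-copy
containment conditioning preserves the two-sided Harris inequality fibrewise" and "the cross-reach stratum is non-negative fibrewise" are
false; no cheap repair: the measure-level versions are a different matter — `Consts.crossReach_measure_of_disconnect_le` (prim-facecert
g15, p338025) proves X at measure level when `μ(S↮T) ≤ μ(S↔T)`, and no measure-level counterexample to either is known through `n = 7`).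
[cite: VandenbergHaggstromKahn2005, Thm. 1.3 (p. 6)] [cite: Linusson2011, Prop. 2.6] [cite: Grimmett2006, §1.2 eq. (1.1) (p. 4)]
-/

namespace Summit.CriticalPhenomena.PercolationContinuityZ3.Theorems

open Literature.Probability.LatticeModels Literature.Probability.Percolation FK FK.RCEval
open scoped symmDiff Classical

namespace Consts

/-! ## "`x ∈ V(C_s)`" is open reachability -/

/-- For `x ≠ s`: some pair of the open edge cluster of `s` contains `x` iff `s ↔ x` (the last pair of an open walk from `s` to `x`
lies in the cluster). [cite: VandenbergHaggstromKahn2005, §1 p. 3 (definition of C_s)] -/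
theorem exists_mem_openEdgeCluster_iff {V : Type*} {ω : BondConfig V} {s x : V} (hsx : s ≠ x) :
    (∃ e ∈ openEdgeCluster ω s, x ∈ e) ↔ (openGraph ω).Reachable s x := by
  constructor
  · rintro ⟨e, he, hx⟩
    exact ((mem_openEdgeCluster_iff ω s e).1 he).2.2 x hx
  · intro h
    obtain ⟨p⟩ := h.symm
    cases p with
    | nil => exact absurd rfl hsx
    | cons hadj q =>
      rename_i w
      obtain ⟨hmem, hne⟩ := (openGraph_adj ω x w).1 hadj
      refine ⟨s(x, w), ?_, Sym2.mem_mk_left _ _⟩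
      rw [mem_openEdgeCluster_iff]
      refine ⟨hmem, by rw [Sym2.mk_isDiag_iff]; exact hne, ?_⟩
      intro v hv
      rcases Sym2.mem_iff.1 hv with rfl | rfl
      · exact h
      · exact ⟨q.reverse⟩

/-! ## The two conjectures in `fibreCount` form -/

/-- Cards of filters by pointwise-equivalent predicates agree, whatever the decidability instances (used to identify the
conjectures' inline filter cards with `FK.fibreCount`). [folklore] -/
theorem card_filter_congr_prop {α : Type*} (s : Finset α) {p q : α → Prop} {hp : DecidablePred p} {hq : DecidablePred q}
    (H : ∀ x, p x ↔ q x) : (@Finset.filter α p hp s).card = (@Finset.filter α q hq s).card :=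
  congrArg Finset.card (@Finset.filter_congr α p q hp hq s fun x _ => H x)

/-- `Consts.OneCopyContainBHK` in `fibreCount` form (the conjecture's inline filter cards, normalised; decidability instances are irrelevant).
[cite: Linusson2011, Prop. 2.6] -/
theorem OneCopyContainBHK.fibreCount_le (h : OneCopyContainBHK) (n : ℕ) (S A : Set (Fin n)) (P Q : Set (Sym2 (Fin n)) → Prop)
    (hP : ∀ ⦃C C' : Set (Sym2 (Fin n))⦄, C ⊆ C' → P C → P C')
    (hQ : ∀ ⦃C C' : Set (Sym2 (Fin n))⦄, C ⊆ C' → Q C → Q C') (M u : Set (Sym2 (Fin n))) (hu : Disjoint u M) :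
    fibreCount M u {ω | ω ∈ {ω : BondConfig (Fin n) | ∀ x ∈ A, ∃ s ∈ S, (openGraph ω).Reachable s x} ∧
          P (⋃ s ∈ S, openEdgeCluster ω s)} {ω | Q (⋃ s ∈ S, openEdgeCluster ω s)} +
      fibreCount M u {ω | ω ∈ {ω : BondConfig (Fin n) | ∀ x ∈ A, ∃ s ∈ S, (openGraph ω).Reachable s x} ∧
          Q (⋃ s ∈ S, openEdgeCluster ω s)} {ω | P (⋃ s ∈ S, openEdgeCluster ω s)} ≤
      fibreCount M u {ω | ω ∈ {ω : BondConfig (Fin n) | ∀ x ∈ A, ∃ s ∈ S, (openGraph ω).Reachable s x} ∧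
          P (⋃ s ∈ S, openEdgeCluster ω s) ∧ Q (⋃ s ∈ S, openEdgeCluster ω s)} (Set.univ : Set (BondConfig (Fin n))) +
      fibreCount M u {ω : BondConfig (Fin n) | ∀ x ∈ A, ∃ s ∈ S, (openGraph ω).Reachable s x}
          {ω | P (⋃ s ∈ S, openEdgeCluster ω s) ∧ Q (⋃ s ∈ S, openEdgeCluster ω s)} := by
  have key := h n S A P Q hP hQ M u hu
  unfold fibreCount
  refine le_of_le_of_eq (le_of_eq_of_le ?_ key) ?_
  · congr 1 <;> exact card_filter_congr_prop _ fun _ => Iff.rfl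
  · congr 1 <;> exact card_filter_congr_prop _ fun _ => Iff.rfl

/-- `Consts.CrossReachBHK` in `fibreCount` form. [cite: Linusson2011, Prop. 2.6] -/
theorem CrossReachBHK.fibreCount_le (h : CrossReachBHK) (n : ℕ) (S : Set (Fin n)) (v : Fin n) (P Q : Set (Sym2 (Fin n)) → Prop)
    (hP : ∀ ⦃C C' : Set (Sym2 (Fin n))⦄, C ⊆ C' → P C → P C')
    (hQ : ∀ ⦃C C' : Set (Sym2 (Fin n))⦄, C ⊆ C' → Q C → Q C') (M u : Set (Sym2 (Fin n))) (hu : Disjoint u M) :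
    fibreCount M u {ω : BondConfig (Fin n) | ¬ (∃ s ∈ S, (openGraph ω).Reachable s v) ∧ P (⋃ s ∈ S, openEdgeCluster ω s)}
        {ω | (∃ s ∈ S, (openGraph ω).Reachable s v) ∧ Q (⋃ s ∈ S, openEdgeCluster ω s)} +
      fibreCount M u {ω : BondConfig (Fin n) | ¬ (∃ s ∈ S, (openGraph ω).Reachable s v) ∧ Q (⋃ s ∈ S, openEdgeCluster ω s)}
        {ω | (∃ s ∈ S, (openGraph ω).Reachable s v) ∧ P (⋃ s ∈ S, openEdgeCluster ω s)} ≤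
      fibreCount M u {ω : BondConfig (Fin n) | ¬ (∃ s ∈ S, (openGraph ω).Reachable s v) ∧
          P (⋃ s ∈ S, openEdgeCluster ω s) ∧ Q (⋃ s ∈ S, openEdgeCluster ω s)} {ω | ∃ s ∈ S, (openGraph ω).Reachable s v} +
      fibreCount M u {ω : BondConfig (Fin n) | ¬ (∃ s ∈ S, (openGraph ω).Reachable s v)}
        {ω | (∃ s ∈ S, (openGraph ω).Reachable s v) ∧ P (⋃ s ∈ S, openEdgeCluster ω s) ∧ Q (⋃ s ∈ S, openEdgeCluster ω s)} := by
  have key := h n S v P Q hP hQ M u hu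
  unfold fibreCount
  refine le_of_le_of_eq (le_of_eq_of_le ?_ key) ?_
  · congr 1 <;> exact card_filter_congr_prop _ fun _ => Iff.rfl
  · congr 1 <;> exact card_filter_congr_prop _ fun _ => Iff.rfl

/-! ## The containment witness on `Fin 7` -/

namespace OneCopyCex

/-- **The containment witness graph** `G₇` on `Fin 7`: listed pairs `03, 04, 13, 15, 24, 25, 35, 45, 16, 56` (parameters unused, `q = 1`).
(lead gen 106, CONTAIN-CEX.md) -/
abbrev cexC : RCEval where
  n := 7
  m := 10
  src := ![0, 0, 1, 1, 2, 2, 3, 4, 1, 5]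
  dst := ![3, 4, 3, 5, 4, 5, 5, 5, 6, 6]
  c := fun _ => 0
  q := 1

/-- The data is valid (pairs distinct). [folklore] -/
theorem validC : cexC.Valid := by decide +kernel

/-- The fibre `M = E(G₇)` (all ten listed pairs), `u = ∅`. [folklore] -/
def MC : BondConfig (Fin 7) := cexC.conf (cexC.firstT 10)

/-- Open reachability `x ↔ y` in the configuration of the mask `a` (computable). [folklore] -/
def jC (a : ℕ) (x y : Fin 7) : Bool := joinedB (cexC.compsOf a) x.val y.val

/-- The complementary mask within `E(G₇)`. [folklore] -/
def cplC (a : ℕ) : ℕ := Nat.xor 1023 a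

/-- Indicator of `L₁`: `5 ↔ 0` and `5 ↔ 2` in copy 0, `5 ↔ 6` in copy 1. [folklore] -/
def gL1 (a : ℕ) : Bool := (jC a 5 0 && jC a 5 2) && jC (cplC a) 5 6

/-- Indicator of `L₂`: `5 ↔ 0` and `5 ↔ 6` in copy 0, `5 ↔ 2` in copy 1. [folklore] -/
def gL2 (a : ℕ) : Bool := (jC a 5 0 && jC a 5 6) && jC (cplC a) 5 2

/-- Indicator of `R₁`: `5 ↔ 0`, `5 ↔ 2`, `5 ↔ 6` in copy 0. [folklore] -/
def gR1 (a : ℕ) : Bool := jC a 5 0 && (jC a 5 2 && jC a 5 6)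

/-- Indicator of `R₂`: `5 ↔ 0` in copy 0, `5 ↔ 2` and `5 ↔ 6` in copy 1. [folklore] -/
def gR2 (a : ℕ) : Bool := jC a 5 0 && (jC (cplC a) 5 2 && jC (cplC a) 5 6)

/-- `L₁ = 252`. (this file's `decide +kernel` evaluation) -/
theorem sum_L1 : sumR (fun a => if gL1 a = true then 1 else 0) 10 0 = 252 := by decide +kernel

/-- `L₂ = 206`. (this file's `decide +kernel` evaluation) -/
theorem sum_L2 : sumR (fun a => if gL2 a = true then 1 else 0) 10 0 = 206 := by decide +kernel

/-- `R₁ = 277`. (this file's `decide +kernel` evaluation) -/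
theorem sum_R1 : sumR (fun a => if gR1 a = true then 1 else 0) 10 0 = 277 := by decide +kernel

/-- `R₂ = 180`. (this file's `decide +kernel` evaluation) -/
theorem sum_R2 : sumR (fun a => if gR2 a = true then 1 else 0) 10 0 = 180 := by decide +kernel

/-- `jC` reads open reachability. [folklore] -/
theorem jC_iff (a : ℕ) (x y : Fin 7) : jC a x y = true ↔ (openGraph (cexC.conf (cexC.tOf a))).Reachable x y :=
  joinedB_iff (D := cexC) a x y

/-- The complementary mask is the `xor` with `2¹⁰ − 1`. [folklore] -/
theorem cplC_eq (a : ℕ) : Nat.xor (2 ^ 10 - 1) a = cplC a := by norm_num [cplC]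

/-- Reading of the containment condition `{ω | ∀ x ∈ {0}, ∃ s ∈ {5}, s ↔ x}` and of `P (C_{5})`, `Q (C_{5})`. [folklore] -/
theorem read7 (ω : BondConfig (Fin 7)) :
    ((∀ x ∈ ({0} : Set (Fin 7)), ∃ s ∈ ({5} : Set (Fin 7)), (openGraph ω).Reachable s x) ↔ (openGraph ω).Reachable 5 0) ∧
      ((∃ e ∈ ⋃ s ∈ ({5} : Set (Fin 7)), openEdgeCluster ω s, (2 : Fin 7) ∈ e) ↔ (openGraph ω).Reachable 5 2) ∧
      ((∃ e ∈ ⋃ s ∈ ({5} : Set (Fin 7)), openEdgeCluster ω s, (6 : Fin 7) ∈ e) ↔ (openGraph ω).Reachable 5 6) := by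
  have h52 : (5 : Fin 7) ≠ 2 := by decide
  have h56 : (5 : Fin 7) ≠ 6 := by decide
  refine ⟨?_, ?_, ?_⟩
  · simp only [Set.mem_singleton_iff, forall_eq, exists_eq_left]
  · rw [Set.biUnion_singleton]; exact exists_mem_openEdgeCluster_iff h52
  · rw [Set.biUnion_singleton]; exact exists_mem_openEdgeCluster_iff h56

/-- Count `L1` of the containment inequality at the fibre `(E(G₇), ∅)` is `252`. [cite: Linusson2011, Prop. 2.6] -/
theorem cL1 : fibreCount MC ∅ {ω | ω ∈ {ω : BondConfig (Fin 7) | ∀ x ∈ ({0} : Set (Fin 7)), ∃ s ∈ ({5} : Set (Fin 7)), (openGraph ω).Reachable s x} ∧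
      (∃ e ∈ ⋃ s ∈ ({5} : Set (Fin 7)), openEdgeCluster ω s, (2 : Fin 7) ∈ e)}
    {ω | (∃ e ∈ ⋃ s ∈ ({5} : Set (Fin 7)), openEdgeCluster ω s, (6 : Fin 7) ∈ e)} = 252 := by
  have h10 : (10 : ℕ) ≤ cexC.m := by decide
  unfold MC
  refine (fibreCount_conf_eq_card_bool validC h10 gL1 fun a _ => ?_).trans ?_
  · rw [cplC_eq]
    simp only [Set.mem_setOf_eq, read7, gL1, Bool.and_eq_true, jC_iff]
  · rw [card_filter_range_eq_sumR, sum_L1]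

/-- Count `L2` of the containment inequality at the fibre `(E(G₇), ∅)` is `206`. [cite: Linusson2011, Prop. 2.6] -/
theorem cL2 : fibreCount MC ∅ {ω | ω ∈ {ω : BondConfig (Fin 7) | ∀ x ∈ ({0} : Set (Fin 7)), ∃ s ∈ ({5} : Set (Fin 7)), (openGraph ω).Reachable s x} ∧
      (∃ e ∈ ⋃ s ∈ ({5} : Set (Fin 7)), openEdgeCluster ω s, (6 : Fin 7) ∈ e)}
    {ω | (∃ e ∈ ⋃ s ∈ ({5} : Set (Fin 7)), openEdgeCluster ω s, (2 : Fin 7) ∈ e)} = 206 := by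
  have h10 : (10 : ℕ) ≤ cexC.m := by decide
  unfold MC
  refine (fibreCount_conf_eq_card_bool validC h10 gL2 fun a _ => ?_).trans ?_
  · rw [cplC_eq]
    simp only [Set.mem_setOf_eq, read7, gL2, Bool.and_eq_true, jC_iff]
  · rw [card_filter_range_eq_sumR, sum_L2]

/-- Count `R1` of the containment inequality at the fibre `(E(G₇), ∅)` is `277`. [cite: Linusson2011, Prop. 2.6] -/
theorem cR1 : fibreCount MC ∅ {ω | ω ∈ {ω : BondConfig (Fin 7) | ∀ x ∈ ({0} : Set (Fin 7)), ∃ s ∈ ({5} : Set (Fin 7)), (openGraph ω).Reachable s x} ∧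
      (∃ e ∈ ⋃ s ∈ ({5} : Set (Fin 7)), openEdgeCluster ω s, (2 : Fin 7) ∈ e) ∧ (∃ e ∈ ⋃ s ∈ ({5} : Set (Fin 7)), openEdgeCluster ω s, (6 : Fin 7) ∈ e)}
    (Set.univ : Set (BondConfig (Fin 7))) = 277 := by
  have h10 : (10 : ℕ) ≤ cexC.m := by decide
  unfold MC
  refine (fibreCount_conf_eq_card_bool validC h10 gR1 fun a _ => ?_).trans ?_
  · rw [cplC_eq]
    simp only [Set.mem_setOf_eq, Set.mem_univ, read7, gR1, Bool.and_eq_true, jC_iff, and_true]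
  · rw [card_filter_range_eq_sumR, sum_R1]

/-- Count `R2` of the containment inequality at the fibre `(E(G₇), ∅)` is `180`. [cite: Linusson2011, Prop. 2.6] -/
theorem cR2 : fibreCount MC ∅ {ω : BondConfig (Fin 7) | ∀ x ∈ ({0} : Set (Fin 7)), ∃ s ∈ ({5} : Set (Fin 7)), (openGraph ω).Reachable s x}
    {ω | (∃ e ∈ ⋃ s ∈ ({5} : Set (Fin 7)), openEdgeCluster ω s, (2 : Fin 7) ∈ e) ∧ (∃ e ∈ ⋃ s ∈ ({5} : Set (Fin 7)), openEdgeCluster ω s, (6 : Fin 7) ∈ e)} = 180 := by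
  have h10 : (10 : ℕ) ≤ cexC.m := by decide
  unfold MC
  refine (fibreCount_conf_eq_card_bool validC h10 gR2 fun a _ => ?_).trans ?_
  · rw [cplC_eq]
    simp only [Set.mem_setOf_eq, read7, gR2, Bool.and_eq_true, jC_iff]
  · rw [card_filter_range_eq_sumR, sum_R2]

end OneCopyCex

/-- **`¬ Consts.OneCopyContainBHK`** — one-copy CONTAINMENT conditioning does NOT preserve the two-sided Harris inequality fibrewise:
at `n = 7`, `S = {5}`, `A = {0}`, `P = [2 ∈ V(C)]`, `Q = [6 ∈ V(C)]`, fibre `(E(G₇), ∅)`: `252 + 206 = 458 > 457 = 277 + 180`.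
refuted-substantive (house conjecture of p336343; the sibling one-copy AVOIDANCE statement `Consts.OneCopyRepelBHK` is a kernel theorem).
[cite: VandenbergHaggstromKahn2005, Thm. 1.3 (p. 6)] [cite: Linusson2011, Prop. 2.6] -/
theorem not_oneCopyContainBHK : ¬ OneCopyContainBHK := by
  intro h
  have key := OneCopyContainBHK.fibreCount_le h 7 {5} {0} (fun C => ∃ e ∈ C, (2 : Fin 7) ∈ e) (fun C => ∃ e ∈ C, (6 : Fin 7) ∈ e)
    (fun _ _ hCC' ⟨e, he, h2⟩ => ⟨e, hCC' he, h2⟩) (fun _ _ hCC' ⟨e, he, h6⟩ => ⟨e, hCC' he, h6⟩) OneCopyCex.MC ∅ disjoint_bot_left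
  beta_reduce at key
  rw [OneCopyCex.cL1, OneCopyCex.cL2, OneCopyCex.cR1, OneCopyCex.cR2] at key
  omega

/-! ## The cross-reach witness on `Fin 8` -/

namespace CrossReachCex

/-- **The cross-reach witness graph** `G₈ = G₇ + 07` on `Fin 8`: listed pairs `03, 04, 13, 15, 24, 25, 35, 45, 16, 56, 07`
(parameters unused, `q = 1`). (lead gen 106, CROSSREACH-CEX.md) -/
abbrev cexX : RCEval where
  n := 8
  m := 11
  src := ![0, 0, 1, 1, 2, 2, 3, 4, 1, 5, 0]
  dst := ![3, 4, 3, 5, 4, 5, 5, 5, 6, 6, 7]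
  c := fun _ => 0
  q := 1

/-- The data is valid (pairs distinct). [folklore] -/
theorem validX : cexX.Valid := by decide +kernel

/-- The fibre `M = E(G₈)` (all eleven listed pairs), `u = ∅`. [folklore] -/
def MX : BondConfig (Fin 8) := cexX.conf (cexX.firstT 11)

/-- Open reachability `x ↔ y` in the configuration of the mask `a` (computable). [folklore] -/
def jX (a : ℕ) (x y : Fin 8) : Bool := joinedB (cexX.compsOf a) x.val y.val

/-- The complementary mask within `E(G₈)`. [folklore] -/
def cplX (a : ℕ) : ℕ := Nat.xor 2047 a

/-- Indicator of `L₁`: copy 0 misses `7` and has `5 ↔ 2`; copy 1 reaches `7` and has `5 ↔ 6`. [folklore] -/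
def xL1 (a : ℕ) : Bool := (!jX a 5 7 && jX a 5 2) && (jX (cplX a) 5 7 && jX (cplX a) 5 6)

/-- Indicator of `L₂`: copy 0 misses `7` and has `5 ↔ 6`; copy 1 reaches `7` and has `5 ↔ 2`. [folklore] -/
def xL2 (a : ℕ) : Bool := (!jX a 5 7 && jX a 5 6) && (jX (cplX a) 5 7 && jX (cplX a) 5 2)

/-- Indicator of `R₁`: copy 0 misses `7`, has `5 ↔ 2` and `5 ↔ 6`; copy 1 reaches `7`. [folklore] -/
def xR1 (a : ℕ) : Bool := (!jX a 5 7 && (jX a 5 2 && jX a 5 6)) && jX (cplX a) 5 7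

/-- Indicator of `R₂`: copy 0 misses `7`; copy 1 reaches `7`, has `5 ↔ 2` and `5 ↔ 6`. [folklore] -/
def xR2 (a : ℕ) : Bool := !jX a 5 7 && (jX (cplX a) 5 7 && (jX (cplX a) 5 2 && jX (cplX a) 5 6))

/-- `L₁ = 206`. (this file's `decide +kernel` evaluation) -/
theorem sum_L1 : sumR (fun a => if xL1 a = true then 1 else 0) 11 0 = 206 := by decide +kernel

/-- `L₂ = 252`. (this file's `decide +kernel` evaluation) -/
theorem sum_L2 : sumR (fun a => if xL2 a = true then 1 else 0) 11 0 = 252 := by decide +kernel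

/-- `R₁ = 180`. (this file's `decide +kernel` evaluation) -/
theorem sum_R1 : sumR (fun a => if xR1 a = true then 1 else 0) 11 0 = 180 := by decide +kernel

/-- `R₂ = 277`. (this file's `decide +kernel` evaluation) -/
theorem sum_R2 : sumR (fun a => if xR2 a = true then 1 else 0) 11 0 = 277 := by decide +kernel

/-- `jX` reads open reachability. [folklore] -/
theorem jX_iff (a : ℕ) (x y : Fin 8) : jX a x y = true ↔ (openGraph (cexX.conf (cexX.tOf a))).Reachable x y :=
  joinedB_iff (D := cexX) a x y

/-- `jX = false` reads non-reachability. [folklore] -/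
theorem jX_false_iff (a : ℕ) (x y : Fin 8) : jX a x y = false ↔ ¬ (openGraph (cexX.conf (cexX.tOf a))).Reachable x y := by
  rw [← Bool.not_eq_true, jX_iff]

/-- The complementary mask is the `xor` with `2¹¹ − 1`. [folklore] -/
theorem cplX_eq (a : ℕ) : Nat.xor (2 ^ 11 - 1) a = cplX a := by norm_num [cplX]

/-- Reading of `∃ s ∈ {5}, s ↔ 7` and of `P (C_{5})`, `Q (C_{5})` on `Fin 8`. [folklore] -/
theorem read8 (ω : BondConfig (Fin 8)) :
    ((∃ s ∈ ({5} : Set (Fin 8)), (openGraph ω).Reachable s 7) ↔ (openGraph ω).Reachable 5 7) ∧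
      ((∃ e ∈ ⋃ s ∈ ({5} : Set (Fin 8)), openEdgeCluster ω s, (2 : Fin 8) ∈ e) ↔ (openGraph ω).Reachable 5 2) ∧
      ((∃ e ∈ ⋃ s ∈ ({5} : Set (Fin 8)), openEdgeCluster ω s, (6 : Fin 8) ∈ e) ↔ (openGraph ω).Reachable 5 6) := by
  have h52 : (5 : Fin 8) ≠ 2 := by decide
  have h56 : (5 : Fin 8) ≠ 6 := by decide
  refine ⟨?_, ?_, ?_⟩
  · simp only [Set.mem_singleton_iff, exists_eq_left]
  · rw [Set.biUnion_singleton]; exact exists_mem_openEdgeCluster_iff h52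
  · rw [Set.biUnion_singleton]; exact exists_mem_openEdgeCluster_iff h56

/-- Count `L1` of the cross-reach inequality at the fibre `(E(G₈), ∅)` is `206`. [cite: Linusson2011, Prop. 2.6] -/
theorem cL1 : fibreCount MX ∅ {ω : BondConfig (Fin 8) | ¬ (∃ s ∈ ({5} : Set (Fin 8)), (openGraph ω).Reachable s 7) ∧
      (∃ e ∈ ⋃ s ∈ ({5} : Set (Fin 8)), openEdgeCluster ω s, (2 : Fin 8) ∈ e)}
    {ω | (∃ s ∈ ({5} : Set (Fin 8)), (openGraph ω).Reachable s 7) ∧ (∃ e ∈ ⋃ s ∈ ({5} : Set (Fin 8)), openEdgeCluster ω s, (6 : Fin 8) ∈ e)} = 206 := by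
  have h11 : (11 : ℕ) ≤ cexX.m := by decide
  unfold MX
  refine (fibreCount_conf_eq_card_bool validX h11 xL1 fun a _ => ?_).trans ?_
  · rw [cplX_eq]
    simp only [Set.mem_setOf_eq, read8, xL1, Bool.and_eq_true, Bool.not_eq_true', jX_iff, jX_false_iff]
  · rw [card_filter_range_eq_sumR, sum_L1]

/-- Count `L2` of the cross-reach inequality at the fibre `(E(G₈), ∅)` is `252`. [cite: Linusson2011, Prop. 2.6] -/
theorem cL2 : fibreCount MX ∅ {ω : BondConfig (Fin 8) | ¬ (∃ s ∈ ({5} : Set (Fin 8)), (openGraph ω).Reachable s 7) ∧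
      (∃ e ∈ ⋃ s ∈ ({5} : Set (Fin 8)), openEdgeCluster ω s, (6 : Fin 8) ∈ e)}
    {ω | (∃ s ∈ ({5} : Set (Fin 8)), (openGraph ω).Reachable s 7) ∧ (∃ e ∈ ⋃ s ∈ ({5} : Set (Fin 8)), openEdgeCluster ω s, (2 : Fin 8) ∈ e)} = 252 := by
  have h11 : (11 : ℕ) ≤ cexX.m := by decide
  unfold MX
  refine (fibreCount_conf_eq_card_bool validX h11 xL2 fun a _ => ?_).trans ?_
  · rw [cplX_eq]
    simp only [Set.mem_setOf_eq, read8, xL2, Bool.and_eq_true, Bool.not_eq_true', jX_iff, jX_false_iff]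
  · rw [card_filter_range_eq_sumR, sum_L2]

/-- Count `R1` of the cross-reach inequality at the fibre `(E(G₈), ∅)` is `180`. [cite: Linusson2011, Prop. 2.6] -/
theorem cR1 : fibreCount MX ∅ {ω : BondConfig (Fin 8) | ¬ (∃ s ∈ ({5} : Set (Fin 8)), (openGraph ω).Reachable s 7) ∧
      (∃ e ∈ ⋃ s ∈ ({5} : Set (Fin 8)), openEdgeCluster ω s, (2 : Fin 8) ∈ e) ∧ (∃ e ∈ ⋃ s ∈ ({5} : Set (Fin 8)), openEdgeCluster ω s, (6 : Fin 8) ∈ e)}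
    {ω | ∃ s ∈ ({5} : Set (Fin 8)), (openGraph ω).Reachable s 7} = 180 := by
  have h11 : (11 : ℕ) ≤ cexX.m := by decide
  unfold MX
  refine (fibreCount_conf_eq_card_bool validX h11 xR1 fun a _ => ?_).trans ?_
  · rw [cplX_eq]
    simp only [Set.mem_setOf_eq, read8, xR1, Bool.and_eq_true, Bool.not_eq_true', jX_iff, jX_false_iff]
  · rw [card_filter_range_eq_sumR, sum_R1]

/-- Count `R2` of the cross-reach inequality at the fibre `(E(G₈), ∅)` is `277`. [cite: Linusson2011, Prop. 2.6] -/
theorem cR2 : fibreCount MX ∅ {ω : BondConfig (Fin 8) | ¬ (∃ s ∈ ({5} : Set (Fin 8)), (openGraph ω).Reachable s 7)}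
    {ω | (∃ s ∈ ({5} : Set (Fin 8)), (openGraph ω).Reachable s 7) ∧
      (∃ e ∈ ⋃ s ∈ ({5} : Set (Fin 8)), openEdgeCluster ω s, (2 : Fin 8) ∈ e) ∧ (∃ e ∈ ⋃ s ∈ ({5} : Set (Fin 8)), openEdgeCluster ω s, (6 : Fin 8) ∈ e)} = 277 := by
  have h11 : (11 : ℕ) ≤ cexX.m := by decide
  unfold MX
  refine (fibreCount_conf_eq_card_bool validX h11 xR2 fun a _ => ?_).trans ?_
  · rw [cplX_eq]
    simp only [Set.mem_setOf_eq, read8, xR2, Bool.and_eq_true, Bool.not_eq_true', jX_iff, jX_false_iff]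
  · rw [card_filter_range_eq_sumR, sum_R2]

end CrossReachCex

/-- **`¬ Consts.CrossReachBHK`** — the CROSS-REACH stratum (copy 0 misses `v`, copy 1 reaches `v`) is NOT non-negative fibrewise:
at `n = 8`, `S = {5}`, `v = 7`, `P = [2 ∈ V(C)]`, `Q = [6 ∈ V(C)]`, fibre `(E(G₈), ∅)`: `206 + 252 = 458 > 457 = 180 + 277`.
refuted-substantive (house conjecture of p336343; the hard-core inequality (HC) survives here because the vacant stratum pays:
`K₀ = 22 ≥ 2`).  [cite: VandenbergHaggstromKahn2005, Thm. 1.3 (p. 6)] [cite: Linusson2011, Prop. 2.6] -/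
theorem not_crossReachBHK : ¬ CrossReachBHK := by
  intro h
  have key := CrossReachBHK.fibreCount_le h 8 {5} 7 (fun C => ∃ e ∈ C, (2 : Fin 8) ∈ e) (fun C => ∃ e ∈ C, (6 : Fin 8) ∈ e)
    (fun _ _ hCC' ⟨e, he, h2⟩ => ⟨e, hCC' he, h2⟩) (fun _ _ hCC' ⟨e, he, h6⟩ => ⟨e, hCC' he, h6⟩) CrossReachCex.MX ∅ disjoint_bot_left
  beta_reduce at key
  rw [CrossReachCex.cL1, CrossReachCex.cL2, CrossReachCex.cR1, CrossReachCex.cR2] at key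
  omega

end Consts

end Summit.CriticalPhenomena.PercolationContinuityZ3.Theorems
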